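import Summits.Ventures.CertifiedManyBodySolver.Theorems.M3x2EdgeSplitSymReplayMoves
import Literature.MathematicalPhysics.QuantumLattice.HubbardEtaPairingNoLROBelowHalfCoupling
import HarnessLib

/-!
# SymReplay S3 — the DICTIONARY: `hamPoly ↦ H_{Λ'}`, `energyPoly ↦ Γ E_Φ`, `densPoly ↦ n_{0σ}`, `spin±Poly ↦ S^±` (T5; proofs by hub-lb-sym-plan-1, rev 3–6)
No summit or crux statement is proved here; no certificate beyond toys is replayed; nothing here predicts superconductivity.
-/

noncomputable section

namespace Summit.Ventures.CertifiedManyBodySolver.Theorems.SymReplay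

open Matrix Finset
open Literature.MathematicalPhysics.QuantumLattice
open Literature.MathematicalPhysics.QuantumLattice.HubbardWave0
open Literature.MathematicalPhysics.QuantumLattice.ThermodynamicLimit
open Literature.Probability.LatticeModels
open Literature.MathematicalPhysics.QuantumManyBody.StateRelaxation
open Summit.Ventures.CertifiedManyBodySolver.Theorems.WardSlot
open scoped ComplexOrder BigOperators

/-- Letters of the two kinds inside the frame. -/
theorem letterOp_cre (Λ' : Finset (Site 2)) (x : Site 2) (σ : Fin 2) (h : x ∈ Λ') :
    letterOp Λ' (cre x σ) = creation (orb (PolySite.pt x h) σ) := by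
  rw [letterOp_of_mem Λ' (cre x σ) h]; simp [ladderLetter, cre]

/-- Helper `letterOp_ann` (S3 chain). -/
theorem letterOp_ann (Λ' : Finset (Site 2)) (x : Site 2) (σ : Fin 2) (h : x ∈ Λ') :
    letterOp Λ' (ann x σ) = annihilation (orb (PolySite.pt x h) σ) := by
  rw [letterOp_of_mem Λ' (ann x σ) h]; simp [ladderLetter, ann]

/-- S3, density conjunct (PROVED): `polyOp (densPoly σ) = n_{0σ}`. -/
theorem dict_dens (frame : List (Site 2)) (hz : (0 : Site 2) ∈ frame.toFinset) (σ : Fin 2) :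
    polyOp frame.toFinset (densPoly σ) = nAt 0 hz σ := by
  simp only [densPoly, polyOp_cons, polyOp_nil, wordOp_cons, wordOp_nil, letterOp_cre _ _ _ hz,
    letterOp_ann _ _ _ hz, add_zero, mul_one, Rat.cast_one, one_smul]
  rfl

/-- A one-coefficient polynomial evaluates to the list sum of its word operators. -/
theorem polyOp_map_one (Λ' : Finset (Site 2)) (l : List (Site 2)) (f : Site 2 → Word) :
    polyOp Λ' (l.map fun x => ((1 : ℚ), f x)) = (l.map fun x => wordOp Λ' (f x)).sum := by
  induction l with
  | nil => simp
  | cons x l ih => rw [List.map_cons, polyOp_cons, ih, List.map_cons, List.sum_cons, Rat.cast_one, one_smul]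

/-- The word `c†_{xσ} c_{xτ}` inside / outside the frame. -/
theorem wordOp_cre_ann (Λ' : Finset (Site 2)) (x : Site 2) (σ τ : Fin 2) :
    wordOp Λ' [cre x σ, ann x τ] =
      if h : x ∈ Λ' then creation (orb (PolySite.pt x h) σ) * annihilation (orb (PolySite.pt x h) τ) else 0 := by
  by_cases h : x ∈ Λ'
  · rw [dif_pos h, wordOp_cons, wordOp_cons, wordOp_nil, letterOp_cre _ _ _ h, letterOp_ann _ _ _ h, mul_one]
  · rw [dif_neg h, wordOp_cons]
    have : letterOp Λ' (cre x σ) = 0 := by simp [letterOp, cre, h]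
    rw [this, zero_mul]

/-- S3, spin-raising conjunct (PROVED): `polyOp (spinPlusPoly frame) = S⁺_{frame}`. -/
theorem dict_spinPlus (frame : List (Site 2)) (hnd : nodupSites frame = true) :
    polyOp frame.toFinset (spinPlusPoly frame) = (spinPlus : FermionOp frame.toFinset) := by
  have hN := nodup_of_nodupSites frame hnd
  rw [spinPlusPoly, polyOp_map_one, ← List.sum_toFinset _ hN, ← Finset.sum_coe_sort]
  unfold spinPlus
  refine Fintype.sum_equiv (sitesEquiv frame.toFinset) _ _ (fun x => ?_)
  rw [wordOp_cre_ann, dif_pos x.2]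
  rfl

/-- S3, spin-lowering conjunct (PROVED): `polyOp (spinMinusPoly frame) = S⁻_{frame} = (S⁺)ᴴ`. -/
theorem dict_spinMinus (frame : List (Site 2)) (hnd : nodupSites frame = true) :
    polyOp frame.toFinset (spinMinusPoly frame) = (spinMinus : FermionOp frame.toFinset) := by
  rw [spinMinus, ← dict_spinPlus frame hnd, spinPlusPoly, spinMinusPoly, polyOp_map_one, polyOp_map_one,
    Matrix.conjTranspose_list_sum, List.map_map]
  congr 1
  refine List.map_congr_left (fun x _ => ?_)
  simp only [Function.comp]
  rw [wordOp_cre_ann, wordOp_cre_ann]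
  by_cases h : x ∈ frame.toFinset
  · rw [dif_pos h, dif_pos h, Matrix.conjTranspose_mul, creation_conjTranspose, annihilation_conjTranspose]
  · rw [dif_neg h, dif_neg h, Matrix.conjTranspose_zero]

/-! #### S3b `EnergyDictSound`, PROVED (rev 5): `energyPoly` IS the `tt'(1,0,8)` mean-energy observable read in
the frame — from the tree's closed forms `hubbardTTPrimeFermionInteraction_meanEnergyObs`,
`hubbardFermionInteraction_meanEnergyObs` (on-site term at `0` + half of each of the four bonds through `0`),
`hubbardFermionInteraction_apply_singleton/_apply_pair`, and `(diagHoppingFermionInteraction 0).meanEnergyObs = 0`. -/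

/-- At `t' = 0` the diagonal-hopping interaction has zero mean-energy observable. -/
theorem diagHopping_zero_meanEnergyObs (R : ℝ) : (diagHoppingFermionInteraction 0).meanEnergyObs R = 0 := by
  unfold FermionInteraction.meanEnergyObs
  refine Finset.sum_eq_zero fun X _ => ?_
  have h : (diagHoppingFermionInteraction 0).Φ X.1 = 0 := by
    unfold diagHoppingFermionInteraction; simp
  rw [h, map_zero, smul_zero]

/-- Helper `unitVec_zero_eq_e1` (S3 chain). -/
theorem unitVec_zero_eq_e1 : (unitVec 0 : Site 2) = e1 := by
  funext j; fin_cases j <;> simp [e1]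

/-- Helper `unitVec_one_eq_e2` (S3 chain). -/
theorem unitVec_one_eq_e2 : (unitVec 1 : Site 2) = e2 := by
  funext j; fin_cases j <;> simp [e2]

/-- A two-letter word `c†_{xσ} c_{yτ}` inside the frame. -/
theorem wordOp_cre_ann₂ (Λ' : Finset (Site 2)) (x y : Site 2) (σ τ : Fin 2) (hx : x ∈ Λ') (hy : y ∈ Λ') :
    wordOp Λ' [cre x σ, ann y τ] = creation (orb (PolySite.pt x hx) σ) * annihilation (orb (PolySite.pt y hy) τ) := by
  rw [wordOp_cons, wordOp_cons, wordOp_nil, letterOp_cre _ _ _ hx, letterOp_ann _ _ _ hy, mul_one]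

/-- The operator of `hop q x y`. -/
theorem polyOp_hop (Λ' : Finset (Site 2)) (q : ℚ) (x y : Site 2) (hx : x ∈ Λ') (hy : y ∈ Λ') :
    polyOp Λ' (hop q x y) =
      ((q : ℚ) : ℂ) • ∑ σ : Fin 2,
        (creation (orb (PolySite.pt x hx) σ) * annihilation (orb (PolySite.pt y hy) σ) +
          creation (orb (PolySite.pt y hy) σ) * annihilation (orb (PolySite.pt x hx) σ)) := by
  simp only [hop, List.flatMap_cons, List.flatMap_nil, List.append_nil, List.cons_append, List.nil_append,
    polyOp_cons, polyOp_nil, wordOp_cre_ann₂ _ _ _ _ _ hx hy, wordOp_cre_ann₂ _ _ _ _ _ hy hx, Fin.sum_univ_two,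
    smul_add, add_zero]
  abel

/-- The operator of `onsite q x`. -/
theorem polyOp_onsite (Λ' : Finset (Site 2)) (q : ℚ) (x : Site 2) (hx : x ∈ Λ') :
    polyOp Λ' (onsite q x) =
      ((q : ℚ) : ℂ) • (creation (orb (PolySite.pt x hx) 0) * annihilation (orb (PolySite.pt x hx) 0) *
        (creation (orb (PolySite.pt x hx) 1) * annihilation (orb (PolySite.pt x hx) 1))) := by
  simp only [onsite, polyOp_cons, polyOp_nil, wordOp_cons, wordOp_nil, letterOp_cre _ _ _ hx, letterOp_ann _ _ _ hx,
    mul_one, add_zero, mul_assoc]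

/-- The embedded on-site term of the Hubbard interaction. -/
theorem embed_hubbard_singleton {Λ' : Finset (Site 2)} (t U : ℝ) (x : Site 2) (hx : x ∈ Λ')
    (h : ({x} : Finset (Site 2)) ⊆ Λ') :
    fermionEmbed (PolySite.incl h) ((hubbardFermionInteraction 2 t U).Φ {x}) =
      (U : ℂ) • (creation (orb (PolySite.pt x hx) 0) * annihilation (orb (PolySite.pt x hx) 0) *
        (creation (orb (PolySite.pt x hx) 1) * annihilation (orb (PolySite.pt x hx) 1))) := by
  rw [hubbardFermionInteraction_apply_singleton, map_smul, map_mul]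
  simp only [numberOp, map_mul, fermionEmbed_creation, fermionEmbed_annihilation, PolySite.incl_pt]

/-- The embedded bond term of the Hubbard interaction, with the two sites renamed propositionally. -/
theorem embed_hubbard_pair {Λ' : Finset (Site 2)} (t U : ℝ) (x₀ : Site 2) (i : Fin 2) (x y : Site 2)
    (hxe : x₀ = x) (hye : x₀ + unitVec i = y) (hx : x ∈ Λ') (hy : y ∈ Λ')
    (h : ({x₀, x₀ + unitVec i} : Finset (Site 2)) ⊆ Λ') :
    fermionEmbed (PolySite.incl h) ((hubbardFermionInteraction 2 t U).Φ {x₀, x₀ + unitVec i}) =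
      -(t : ℂ) • ∑ σ : Fin 2,
        (creation (orb (PolySite.pt x hx) σ) * annihilation (orb (PolySite.pt y hy) σ) +
          creation (orb (PolySite.pt y hy) σ) * annihilation (orb (PolySite.pt x hx) σ)) := by
  subst hxe; subst hye
  rw [hubbardFermionInteraction_apply_pair, map_smul, map_sum]
  simp only [map_add, map_mul, annihilation_conjTranspose, fermionEmbed_creation, fermionEmbed_annihilation,
    PolySite.incl_pt]

/-- Helper `stub_energyDictSound` (S3 chain). -/
theorem stub_energyDictSound : EnergyDictSound := by
  intro frame hnd h0
  have hz : (0 : Site 2) ∈ frame.toFinset := h0 (zero_mem_thicken_zero 1)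
  have he1 : e1 ∈ frame.toFinset := h0 (unitVec_zero_eq_e1 ▸ unitVec_mem_thicken_one 0)
  have he2 : e2 ∈ frame.toFinset := h0 (unitVec_one_eq_e2 ▸ unitVec_mem_thicken_one 1)
  have hne1 : -e1 ∈ frame.toFinset := h0 (unitVec_zero_eq_e1 ▸ neg_unitVec_mem_thicken_one 0)
  have hne2 : -e2 ∈ frame.toFinset := h0 (unitVec_one_eq_e2 ▸ neg_unitVec_mem_thicken_one 1)
  -- the tree side
  rw [hubbardTTPrimeFermionInteraction_meanEnergyObs, diagHopping_zero_meanEnergyObs, add_zero,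
    hubbardFermionInteraction_meanEnergyObs]
  simp only [map_add, map_smul, fermionEmbed_fermionEmbed, PolySite.incl_trans, Fin.sum_univ_two]
  rw [embed_hubbard_singleton 1 8 0 hz,
    embed_hubbard_pair 1 8 0 0 0 e1 rfl (by rw [zero_add, unitVec_zero_eq_e1]) hz he1,
    embed_hubbard_pair 1 8 0 1 0 e2 rfl (by rw [zero_add, unitVec_one_eq_e2]) hz he2,
    embed_hubbard_pair 1 8 (-unitVec 0) 0 (-e1) 0 (by rw [unitVec_zero_eq_e1]) (by rw [neg_add_cancel]) hne1 hz,
    embed_hubbard_pair 1 8 (-unitVec 1) 1 (-e2) 0 (by rw [unitVec_one_eq_e2]) (by rw [neg_add_cancel]) hne2 hz]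
  -- the checker side
  rw [energyPoly, polyOp_append, polyOp_append, polyOp_append, polyOp_append, polyOp_onsite _ _ _ hz,
    polyOp_hop _ _ _ _ hz he1, polyOp_hop _ _ _ _ hz he2, polyOp_hop _ _ _ _ hne1 hz, polyOp_hop _ _ _ _ hne2 hz]
  simp only [smul_smul]
  push_cast
  norm_num
  abel

/-! #### S3a `HamDictSound`, PROVED (rev 6): `hamPoly frame` IS the `tt'(1,0,8)` local Hamiltonian of the frame
(free b.c.) — via `hubbardTTPrimeFermionInteraction_localHamiltonian`, `(diagHoppingFermionInteraction 0).localHamiltonian = 0`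
and `hubbardFermionInteraction_localHamiltonian : … = hamiltonian (polyGraph Λ') 1 8`, with the graph Hamiltonian
rewritten over `Λ'.attach` and its bonds exactly as in the tree's proof of the latter
(`ite_zdGraph_adj_eq_sum`, `sum_attach_ite_eq`). -/

/-- `polyOp` of a `flatMap` is the sum of the `polyOp`s. -/
theorem polyOp_flatMap {α : Type*} (Λ' : Finset (Site 2)) (l : List α) (f : α → QPoly) :
    polyOp Λ' (l.flatMap f) = (l.map fun a => polyOp Λ' (f a)).sum := by
  induction l with
  | nil => simp
  | cons a l ih => rw [List.flatMap_cons, polyOp_append, ih, List.map_cons, List.sum_cons]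

/-- Helper `polyOp_ite` (S3 chain). -/
theorem polyOp_ite (Λ' : Finset (Site 2)) (c : Prop) [Decidable c] (p : QPoly) :
    polyOp Λ' (if c then p else []) = if c then polyOp Λ' p else 0 := by
  split_ifs <;> simp

/-- Helper `e1_ne_e2` (S3 chain). -/
theorem e1_ne_e2 : e1 ≠ e2 := by decide

/-- The checker's nearest-neighbour test `y = x + e₁ ∨ y = x + e₂`, as the tree's direction sum. -/
theorem ite_nnTest_eq_sum {M : Type*} [AddCommMonoid M] (x y : Site 2) (T : M) :
    (if (siteEq y (x + e1) || siteEq y (x + e2)) = true then T else 0) =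
      ∑ i : Fin 2, (if y = x + unitVec i then T else 0) := by
  rw [Fin.sum_univ_two, unitVec_zero_eq_e1, unitVec_one_eq_e2]
  by_cases h1 : y = x + e1
  · have h2 : ¬ y = x + e2 := fun h => e1_ne_e2 (add_left_cancel (h1.symm.trans h))
    have hc : (siteEq y (x + e1) || siteEq y (x + e2)) = true := by
      rw [Bool.or_eq_true, siteEq_iff, siteEq_iff]; exact Or.inl h1
    rw [if_pos hc, if_pos h1, if_neg h2, add_zero]
  · by_cases h2 : y = x + e2
    · have hc : (siteEq y (x + e1) || siteEq y (x + e2)) = true := by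
        rw [Bool.or_eq_true, siteEq_iff, siteEq_iff]; exact Or.inr h2
      rw [if_pos hc, if_neg h1, if_pos h2, zero_add]
    · have hc : ¬ (siteEq y (x + e1) || siteEq y (x + e2)) = true := by
        rw [Bool.or_eq_true, siteEq_iff, siteEq_iff]; exact fun h => h.elim h1 h2
      rw [if_neg hc, if_neg h1, if_neg h2, add_zero]

/-- The graph Hubbard Hamiltonian of `polyGraph Λ'` over `Λ'.attach` (the tree's `hR`, verbatim up to names). -/
theorem hamiltonian_polyGraph_attach (Λ' : Finset (Site 2)) (t U : ℝ) :
    hamiltonian (polyGraph Λ') t U =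
      -(t : ℂ) • ∑ x ∈ Λ'.attach, ∑ y ∈ Λ'.attach, (if (zdGraph 2).Adj x.1 y.1 then hopT Λ' x y else 0) +
        (U : ℂ) • ∑ x ∈ Λ'.attach, nnT Λ' x := by
  classical
  let e : PolySite Λ' ≃ {x // x ∈ Λ'} :=
    ⟨fun a => ⟨ofLex a.1, PolySite.ofLex_mem a⟩, fun x => PolySite.pt x.1 x.2, fun a => PolySite.pt_ofLex a,
      fun x => Subtype.ext rfl⟩
  have hsum : ∀ (f : PolySite Λ' → FermionOp Λ'), ∑ a, f a = ∑ x ∈ Λ'.attach, f (PolySite.pt x.1 x.2) := by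
    intro f
    rw [← Finset.univ_eq_attach]
    exact Fintype.sum_equiv e f (fun x => f (PolySite.pt x.1 x.2)) fun a => by
      rw [show PolySite.pt (e a).1 (e a).2 = e.symm (e a) from rfl, Equiv.symm_apply_apply]
  rw [hamiltonian, hsum, hsum]
  congr 2
  refine Finset.sum_congr rfl fun x _ => ?_
  rw [hsum]
  refine Finset.sum_congr rfl fun y _ => ?_
  by_cases h : (zdGraph 2).Adj x.1 y.1
  · rw [if_pos h]
    exact Finset.sum_congr rfl fun σ _ => if_pos ((polyGraph_adj _ _).2 h)
  · rw [if_neg h]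
    exact Finset.sum_eq_zero fun σ _ => if_neg fun h' => h ((polyGraph_adj _ _).1 h')

/-- The hopping double sum as a sum over the bonds of `Λ'` (the tree's `hhopsum`, verbatim up to names). -/
theorem hop_attach_sum_eq_bonds (Λ' : Finset (Site 2)) :
    ∑ x ∈ Λ'.attach, ∑ y ∈ Λ'.attach, (if (zdGraph 2).Adj x.1 y.1 then hopT Λ' x y else 0) =
      ∑ i : Fin 2, ∑ x ∈ Λ'.attach,
        if h : x.1 + unitVec i ∈ Λ' then hopT Λ' x ⟨x.1 + unitVec i, h⟩ + hopT Λ' ⟨x.1 + unitVec i, h⟩ x else 0 := by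
  classical
  simp_rw [ite_zdGraph_adj_eq_sum]
  have hswap : ∀ x : {x // x ∈ Λ'},
      ∑ y ∈ Λ'.attach, ∑ i : Fin 2, ((if y.1 = x.1 + unitVec i then hopT Λ' x y else 0) +
          (if x.1 = y.1 + unitVec i then hopT Λ' x y else 0)) =
        ∑ i : Fin 2, ∑ y ∈ Λ'.attach, ((if y.1 = x.1 + unitVec i then hopT Λ' x y else 0) +
          (if x.1 = y.1 + unitVec i then hopT Λ' x y else 0)) := fun x => Finset.sum_comm
  simp_rw [hswap]
  rw [Finset.sum_comm]
  refine Finset.sum_congr rfl fun i _ => ?_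
  simp only [Finset.sum_add_distrib]
  have h1 : ∀ x : {x // x ∈ Λ'}, ∑ y ∈ Λ'.attach, (if y.1 = x.1 + unitVec i then hopT Λ' x y else 0) =
      if h : x.1 + unitVec i ∈ Λ' then hopT Λ' x ⟨x.1 + unitVec i, h⟩ else 0 := fun x =>
    sum_attach_ite_eq Λ' (x.1 + unitVec i) (fun y => hopT Λ' x y)
  have h2 : ∑ x ∈ Λ'.attach, ∑ y ∈ Λ'.attach, (if x.1 = y.1 + unitVec i then hopT Λ' x y else 0) =
      ∑ y ∈ Λ'.attach, if h : y.1 + unitVec i ∈ Λ' then hopT Λ' ⟨y.1 + unitVec i, h⟩ y else 0 := by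
    rw [Finset.sum_comm]
    exact Finset.sum_congr rfl fun y _ => sum_attach_ite_eq Λ' (y.1 + unitVec i) (fun x => hopT Λ' x y)
  simp_rw [h1]
  rw [h2, ← Finset.sum_add_distrib]
  refine Finset.sum_congr rfl fun x _ => ?_
  by_cases h : x.1 + unitVec i ∈ Λ'
  · rw [dif_pos h, dif_pos h, dif_pos h]
  · rw [dif_neg h, dif_neg h, dif_neg h, add_zero]

/-- The checker's hopping double sum over the frame list, as the same bond sum. -/
theorem polyOp_hopPart (frame : List (Site 2)) (hN : frame.Nodup) :
    (frame.map fun x => polyOp frame.toFinset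
        (frame.flatMap fun y => if (siteEq y (x + e1) || siteEq y (x + e2)) then hop (-1) x y else [])).sum =
      (((-1 : ℚ) : ℚ) : ℂ) • ∑ i : Fin 2, ∑ x ∈ frame.toFinset.attach,
        if h : x.1 + unitVec i ∈ frame.toFinset then
          hopT _ x ⟨x.1 + unitVec i, h⟩ + hopT _ ⟨x.1 + unitVec i, h⟩ x else 0 := by
  classical
  have step1 : ∀ x : {x // x ∈ frame.toFinset}, polyOp frame.toFinset (frame.flatMap fun y =>
      if (siteEq y (x.1 + e1) || siteEq y (x.1 + e2)) then hop (-1) x.1 y else []) =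
      ∑ i : Fin 2, if h : x.1 + unitVec i ∈ frame.toFinset then
          (((-1 : ℚ) : ℚ) : ℂ) • (hopT _ x ⟨x.1 + unitVec i, h⟩ + hopT _ ⟨x.1 + unitVec i, h⟩ x) else 0 := by
    intro x
    rw [polyOp_flatMap, ← List.sum_toFinset _ hN, ← Finset.sum_attach frame.toFinset]
    have hy : ∀ y : {y // y ∈ frame.toFinset}, polyOp frame.toFinset
        (if (siteEq y.1 (x.1 + e1) || siteEq y.1 (x.1 + e2)) then hop (-1) x.1 y.1 else []) =
        ∑ i : Fin 2, if y.1 = x.1 + unitVec i then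
          (((-1 : ℚ) : ℚ) : ℂ) • (hopT _ x y + hopT _ y x) else 0 := by
      intro y
      rw [polyOp_ite, polyOp_hop _ _ _ _ x.2 y.2, ite_nnTest_eq_sum]
      simp only [hopT, ← Finset.sum_add_distrib]
    rw [Finset.sum_congr rfl fun y _ => hy y, Finset.sum_comm]
    refine Finset.sum_congr rfl fun i _ => ?_
    exact sum_attach_ite_eq frame.toFinset (x.1 + unitVec i)
      (fun y => (((-1 : ℚ) : ℚ) : ℂ) • (hopT _ x y + hopT _ y x))
  rw [← List.sum_toFinset _ hN, ← Finset.sum_attach frame.toFinset, Finset.sum_congr rfl fun x _ => step1 x,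
    Finset.sum_comm, Finset.smul_sum]
  refine Finset.sum_congr rfl fun i _ => ?_
  rw [Finset.smul_sum]
  refine Finset.sum_congr rfl fun x _ => ?_
  by_cases h : x.1 + unitVec i ∈ frame.toFinset
  · rw [dif_pos h, dif_pos h]
  · rw [dif_neg h, dif_neg h, smul_zero]

/-- The checker's on-site sum over the frame list. -/
theorem polyOp_onsitePart (frame : List (Site 2)) (hN : frame.Nodup) :
    (frame.map fun x => polyOp frame.toFinset (onsite 8 x)).sum =
      (((8 : ℚ) : ℚ) : ℂ) • ∑ x ∈ frame.toFinset.attach, nnT _ x := by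
  classical
  rw [← List.sum_toFinset _ hN, ← Finset.sum_attach frame.toFinset, Finset.smul_sum]
  refine Finset.sum_congr rfl fun x _ => ?_
  rw [polyOp_onsite _ _ _ x.2]
  simp only [nnT, numberOp]

/-- Helper `stub_hamDictSound` (S3 chain). -/
theorem stub_hamDictSound : HamDictSound := by
  intro frame hnd
  classical
  have hN : frame.Nodup := nodup_of_nodupSites frame hnd
  rw [hubbardTTPrimeFermionInteraction_localHamiltonian, diagHoppingFermionInteraction_zero_localHamiltonian, add_zero,
    hubbardFermionInteraction_localHamiltonian, hamiltonian_polyGraph_attach, hop_attach_sum_eq_bonds,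
    hamPoly, polyOp_append, polyOp_flatMap, polyOp_flatMap, polyOp_onsitePart frame hN, polyOp_hopPart frame hN]
  push_cast
  rw [neg_smul, one_smul, add_comm]

/-- **S3 PROVED (assembled)**: the dictionary, from the proved Hamiltonian conjuncts S3a/S3b and the proved
density / spin-ladder conjuncts. -/
theorem stub_dictionarySound : DictionarySound := fun frame hnd =>
  ⟨stub_hamDictSound frame hnd, stub_energyDictSound frame hnd, fun hz σ => dict_dens frame hz σ,
    dict_spinPlus frame hnd, dict_spinMinus frame hnd⟩

end Summit.Ventures.CertifiedManyBodySolver.Theorems.SymReplay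

end
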